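import Summits.CriticalPhenomena.Ising3DConformalLimit.Theorems.PerfectScreeningSubharmonicOffOriginKlBandDefs

/-!
# Crux `PerfectScreening.SubharmonicOffOrigin` (stmt-CriticalPhenomena-1341), line
`kl-band-positivity`: stub `stub_isoMassDisintegration` (the ISO-MASS DISINTEGRATION)

This file proves the registered stub
`stub_isoMassDisintegration : Sig.stub_isoMassDisintegration` of the checked skeleton of the line
`kl-band-positivity` (objects and signatures in `PerfectScreeningSubharmonicOffOriginKlBandDefs`):
a finite joint spectral measure `ρ` on `ℝ × ℝ²` carried by the spectral window `(0,1] × ℝ²` and by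
the LSC region `{s ≥ 0}` (`s = λ + 1/λ − 2 − k̂²` the free invariant mass), representing a function
`G : ℤ³ → ℝ` in a direction `i₀` (`G(x) = ∫ λ^{|x_{i₀}|} cos(k·x̌) dρ(λ,k)`), disintegrates along
the lattice invariant mass into an iso-mass (Källén–Lehmann) representation `IsoMassRep i₀ G m κ`:
`G(x) = ∫ u_θ[κ θ](x) dm(θ)` with a finite mass measure `m` carried by `θ ∈ (0,1]` and a Markov
kernel `κ` of fibre measures on momentum space.

Proof (pure measure theory, no new objects):
* the change of variables. On the carrier `S = specWindow ∩ lscViolatingᶜ` put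
  `c = λ + 1/λ − k̂² ≥ 2` and `θ(λ,k) = 2/(c + √(c² − 4))`, the small root of `θ + 1/θ = c`
  (`isoMass_smallRoot`: `θ ∈ (0,1]`, `θ² + 1 = cθ`), so that `layerSymbol θ k = λ` EXACTLY
  (`isoMass_layerSymbol_of_root`: with `B = 1 + θ² + θk̂² = θ(λ + 1/λ)`,
  `B² − 4θ² = θ²(1/λ − λ)²` and `1/λ − λ ≥ 0`, `2θ/(B + √(B² − 4θ²)) = 2θ/(2θ/λ) = λ`);
  both facts packaged on the carrier in `isoMass_change`.
* push `ρ` forward under the measurable map `Φ(λ,k) = (θ(λ,k), k)`; `ρ' = Φ_*ρ` is finite and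
  `ρ'`-a.e. `θ ∈ (0,1]`; disintegrate `ρ' = ρ'.fst ⊗ₘ ρ'.condKernel` (Mathlib's
  `MeasureTheory.Measure.condKernel`, `ℝ²` is standard Borel), `m := ρ'.fst`, `κ := ρ'.condKernel`.
* the five fields: `m` finite and `κ` Markov are instances; `m (0,1]ᶜ = ρ' {θ ∉ (0,1]} = 0`;
  for each `x`, the integrand `F_x(θ,k) = λ_θ(k)^{|x_{i₀}|} cos(k·x̌)` is measurable and bounded
  by `1` `ρ'`-a.e., hence `ρ'`-integrable, and
  `G(x) = ∫ λ^{|n|} cos dρ = ∫ F_x ∘ Φ dρ = ∫ F_x dρ' = ∫ (∫ F_x(θ,k) dκ_θ(k)) dm(θ) = ∫ u_θ(x) dm`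
  (`integral_congr_ae` on `S`, `integral_map`, `Measure.integral_condKernel`), with integrability of
  `θ ↦ u_θ(x)` from `Integrable.integral_condKernel`.

References: the disintegration theorem for standard Borel spaces as in Mathlib
(`Mathlib/Probability/Kernel/Disintegration/StandardBorel.lean`); the iso-mass
re-coordinatisation of transfer-matrix spectral measures is classical (Glimm–Jaffe,
*Quantum Physics* (1987) §6.1).
-/

noncomputable section

open MeasureTheory ProbabilityTheory
open Literature.Probability.LatticeModels

namespace Summit.CriticalPhenomena.Ising3DConformalLimit.Theorems.PerfectScreening.KlBand

/-! ## Elementary bounds on the layer symbol -/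

/-- `0 ≤ λ_θ(k) ≤ 1` for `θ ≥ 0` (the denominator `B + √(B² − 4θ²)` is positive and
`B ≥ 1 + θ² ≥ 2θ`). -/
theorem isoMass_layerSymbol_mem_Icc {θ : ℝ} (hθ : 0 ≤ θ) (k : Fin 2 → ℝ) :
    layerSymbol θ k ∈ Set.Icc (0 : ℝ) 1 := by
  have h1 : 0 ≤ θ * khatSq k := mul_nonneg hθ (khatSq_nonneg k)
  have h2 := Real.sqrt_nonneg ((1 + θ ^ 2 + θ * khatSq k) ^ 2 - 4 * θ ^ 2)
  have hden : 0 < (1 + θ ^ 2 + θ * khatSq k) +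
      Real.sqrt ((1 + θ ^ 2 + θ * khatSq k) ^ 2 - 4 * θ ^ 2) := by
    have h3 := sq_nonneg θ
    linarith
  unfold layerSymbol
  refine ⟨div_nonneg (by linarith) hden.le, ?_⟩
  rw [div_le_one hden]
  nlinarith [sq_nonneg (1 - θ)]

/-- `|λ_θ(k)ⁿ cos(k·w)| ≤ 1` for `θ ≥ 0`. -/
theorem isoMass_norm_integrand_le {θ : ℝ} (hθ : 0 ≤ θ) (k : Fin 2 → ℝ) (n : ℕ) (w : Fin 2 → ℤ) :
    ‖layerSymbol θ k ^ n * Real.cos (phase k w)‖ ≤ 1 := by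
  have hl := isoMass_layerSymbol_mem_Icc hθ k
  rw [Real.norm_eq_abs, abs_mul, abs_pow, abs_of_nonneg hl.1]
  calc layerSymbol θ k ^ n * |Real.cos (phase k w)| ≤ 1 * 1 :=
        mul_le_mul (pow_le_one₀ hl.1 hl.2) (Real.abs_cos_le_one _) (abs_nonneg _) zero_le_one
    _ = 1 := one_mul 1

/-! ## Measurability -/

/-- `k̂²` is measurable. -/
theorem isoMass_measurable_khatSq : Measurable khatSq := by
  have h : Continuous khatSq := by unfold khatSq; fun_prop
  exact h.measurable

/-- The rest-frame rate `θ(λ,k) = 2/(c + √(c² − 4))`, `c = λ + 1/λ − k̂²`, is a measurable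
function of the spectral point `(λ,k)` (on all of `ℝ × ℝ²`, junk values included). -/
theorem isoMass_measurable_theta :
    Measurable fun p : ℝ × (Fin 2 → ℝ) =>
      2 / ((p.1 + p.1⁻¹ - khatSq p.2) + Real.sqrt ((p.1 + p.1⁻¹ - khatSq p.2) ^ 2 - 4)) := by
  have hc : Measurable fun p : ℝ × (Fin 2 → ℝ) => p.1 + p.1⁻¹ - khatSq p.2 :=
    (measurable_fst.add measurable_fst.inv).sub (isoMass_measurable_khatSq.comp measurable_snd)
  exact measurable_const.div (hc.add ((hc.pow_const 2).sub_const 4).sqrt)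

/-- The layer symbol is jointly measurable in `(θ, k)` (on all of `ℝ × ℝ²`). -/
theorem isoMass_measurable_layerSymbol :
    Measurable fun q : ℝ × (Fin 2 → ℝ) => layerSymbol q.1 q.2 := by
  have hB : Measurable fun q : ℝ × (Fin 2 → ℝ) => 1 + q.1 ^ 2 + q.1 * khatSq q.2 :=
    (measurable_const.add (measurable_fst.pow_const 2)).add
      (measurable_fst.mul (isoMass_measurable_khatSq.comp measurable_snd))
  unfold layerSymbol
  exact (measurable_const.mul measurable_fst).div
    (hB.add ((hB.pow_const 2).sub (measurable_const.mul (measurable_fst.pow_const 2))).sqrt)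

/-- The fibre integrand `F(θ,k) = λ_θ(k)ⁿ cos(k·w)` is jointly measurable. -/
theorem isoMass_measurable_integrand (n : ℕ) (w : Fin 2 → ℤ) :
    Measurable fun q : ℝ × (Fin 2 → ℝ) => layerSymbol q.1 q.2 ^ n * Real.cos (phase q.2 w) := by
  have hph : Continuous fun k : Fin 2 → ℝ => phase k w := by unfold phase; fun_prop
  exact (isoMass_measurable_layerSymbol.pow_const n).mul
    (Real.measurable_cos.comp (hph.measurable.comp measurable_snd))

/-! ## The change of variables `(λ,k) ↦ (θ(λ,k), k)` -/

/-- For `c ≥ 2`, `θ = 2/(c + √(c² − 4))` lies in `(0,1]` and is a root of `θ² + 1 = cθ`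
(rationalise: `θ = (c − √(c² − 4))/2`, `1/θ = (c + √(c² − 4))/2`). -/
theorem isoMass_smallRoot {c θ : ℝ} (hc : 2 ≤ c) (hθ : θ = 2 / (c + Real.sqrt (c ^ 2 - 4))) :
    0 < θ ∧ θ ≤ 1 ∧ θ ^ 2 + 1 = c * θ := by
  have hdisc : 0 ≤ c ^ 2 - 4 := by nlinarith
  set s : ℝ := Real.sqrt (c ^ 2 - 4) with hs
  have hs0 : 0 ≤ s := Real.sqrt_nonneg _
  have hs2 : s ^ 2 = c ^ 2 - 4 := by rw [hs, Real.sq_sqrt hdisc]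
  have hden : 2 ≤ c + s := by linarith
  have hdenpos : 0 < c + s := by linarith
  refine ⟨?_, ?_, ?_⟩
  · rw [hθ]; positivity
  · rw [hθ, div_le_one hdenpos]; exact hden
  · rw [hθ]
    field_simp
    nlinarith [hs2]

/-- **The key identity of the change of variables.** If `0 < λ ≤ 1`, `0 < θ` and
`θ² + 1 = (λ + 1/λ − k̂²)θ` (i.e. `θ + 1/θ + k̂² = λ + 1/λ`), then `layerSymbol θ k = λ`:
`λ` is the small root of `μ + 1/μ = θ + 1/θ + k̂²`. -/
theorem isoMass_layerSymbol_of_root {l θ : ℝ} (k : Fin 2 → ℝ) (hl0 : 0 < l) (hl1 : l ≤ 1)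
    (hθ0 : 0 < θ) (hroot : θ ^ 2 + 1 = (l + l⁻¹ - khatSq k) * θ) : layerSymbol θ k = l := by
  have hlne : l ≠ 0 := hl0.ne'
  -- `B = 1 + θ² + θ k̂² = θ (λ + 1/λ)`
  have hB : 1 + θ ^ 2 + θ * khatSq k = θ * (l + l⁻¹) := by linear_combination hroot
  -- the discriminant is a perfect square
  have hdisc : (θ * (l + l⁻¹)) ^ 2 - 4 * θ ^ 2 = (θ * (l⁻¹ - l)) ^ 2 := by
    have h1 : l * l⁻¹ = 1 := mul_inv_cancel₀ hlne
    linear_combination (4 * θ ^ 2) * h1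
  have hnn : 0 ≤ θ * (l⁻¹ - l) := by
    refine mul_nonneg hθ0.le ?_
    have : 1 ≤ l⁻¹ := one_le_inv_iff₀.2 ⟨hl0, hl1⟩
    linarith
  have hsqrt : Real.sqrt ((θ * (l + l⁻¹)) ^ 2 - 4 * θ ^ 2) = θ * (l⁻¹ - l) := by
    rw [hdisc, Real.sqrt_sq hnn]
  unfold layerSymbol
  rw [hB, hsqrt]
  field_simp
  ring

/-- The change of variables on the carrier `specWindow ∩ lscViolatingᶜ` (`λ ∈ (0,1]`, `s ≥ 0`, so
`c = λ + 1/λ − k̂² ≥ 2`): `θ(λ,k) ∈ (0,1]` and `layerSymbol (θ(λ,k)) k = λ`. -/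
theorem isoMass_change {p : ℝ × (Fin 2 → ℝ)} (hp : p ∈ specWindow ∩ lscViolatingᶜ) {θ : ℝ}
    (hθ : θ = 2 / ((p.1 + p.1⁻¹ - khatSq p.2) + Real.sqrt ((p.1 + p.1⁻¹ - khatSq p.2) ^ 2 - 4))) :
    θ ∈ Set.Ioc (0 : ℝ) 1 ∧ layerSymbol θ p.2 = p.1 := by
  rcases hp with ⟨hw, hl⟩
  simp only [specWindow, Set.mem_prod, Set.mem_Ioc, Set.mem_univ, and_true] at hw
  simp only [lscViolating, Set.mem_compl_iff, Set.mem_setOf_eq, not_lt, freeMass] at hl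
  have hc : 2 ≤ p.1 + p.1⁻¹ - khatSq p.2 := by linarith
  obtain ⟨h0, h1, hroot⟩ := isoMass_smallRoot hc hθ
  exact ⟨⟨h0, h1⟩, isoMass_layerSymbol_of_root p.2 hw.1 hw.2 h0 hroot⟩

/-! ## The disintegration -/

/-- **Stub 3 of the line `kl-band-positivity` (support; ISO-MASS DISINTEGRATION).** A finite joint
spectral measure carried by `(0,1] × ℝ²` and by the LSC region `{s ≥ 0}` which represents `G` in
direction `i₀` disintegrates along the lattice invariant mass into an iso-mass representation of
`G`: `m := (Φ_*ρ).fst`, `κ := (Φ_*ρ).condKernel` for `Φ(λ,k) = (θ(λ,k), k)`. -/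
theorem stub_isoMassDisintegration : Sig.stub_isoMassDisintegration := by
  intro G i₀ ρ hfin hwin hlsc hrep
  -- the carrier is `ρ`-conull
  have hS : ∀ᵐ p ∂ρ, p ∈ specWindow ∩ lscViolatingᶜ := by
    have h0 : ρ (specWindow ∩ lscViolatingᶜ)ᶜ = 0 := by
      rw [Set.compl_inter, compl_compl]
      exact measure_union_null hwin hlsc
    exact Filter.eventually_mem_set.2 (mem_ae_iff.2 h0)
  -- the change of variables `Φ(λ,k) = (θ(λ,k), k)` and its pointwise content on the carrier
  obtain ⟨Φ, hΦ⟩ : ∃ Φ : ℝ × (Fin 2 → ℝ) → ℝ × (Fin 2 → ℝ), Φ = fun p =>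
      (2 / ((p.1 + p.1⁻¹ - khatSq p.2) + Real.sqrt ((p.1 + p.1⁻¹ - khatSq p.2) ^ 2 - 4)), p.2) :=
    ⟨_, rfl⟩
  have hΦm : Measurable Φ := by
    rw [hΦ]
    exact isoMass_measurable_theta.prodMk measurable_snd
  have hΦS : ∀ p ∈ specWindow ∩ lscViolatingᶜ,
      (Φ p).1 ∈ Set.Ioc (0 : ℝ) 1 ∧ layerSymbol (Φ p).1 p.2 = p.1 ∧ (Φ p).2 = p.2 := by
    intro p hp
    rw [hΦ]
    exact ⟨(isoMass_change hp rfl).1, (isoMass_change hp rfl).2, rfl⟩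
  -- the fibre integrands `F_x(θ,k) = λ_θ(k)^{|x_{i₀}|} cos(k·x̌)`
  obtain ⟨F, hF⟩ : ∃ F : Site 3 → ℝ × (Fin 2 → ℝ) → ℝ,
      F = fun x q => layerSymbol q.1 q.2 ^ (x i₀).natAbs * Real.cos (phase q.2 (perp i₀ x)) :=
    ⟨_, rfl⟩
  have hFm : ∀ x : Site 3, Measurable (F x) := by
    intro x
    rw [hF]
    exact isoMass_measurable_integrand (x i₀).natAbs (perp i₀ x)
  have hFun : ∀ (θ : ℝ) (ν : Measure (Fin 2 → ℝ)) (x : Site 3),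
      isoMassFun i₀ θ ν x = ∫ k, F x (θ, k) ∂ν := by
    intro θ ν x
    rw [hF]
    rfl
  have hFbd : ∀ (x : Site 3) (q : ℝ × (Fin 2 → ℝ)), q.1 ∈ Set.Ioc (0 : ℝ) 1 → ‖F x q‖ ≤ 1 := by
    intro x q hq
    rw [hF]
    exact isoMass_norm_integrand_le hq.1.le q.2 (x i₀).natAbs (perp i₀ x)
  have hFΦ : ∀ x : Site 3, ∀ p ∈ specWindow ∩ lscViolatingᶜ,
      F x (Φ p) = p.1 ^ (x i₀).natAbs * Real.cos (phase p.2 (perp i₀ x)) := by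
    intro x p hp
    obtain ⟨-, h1, h2⟩ := hΦS p hp
    rw [hF]
    simp only [h2, h1]
  -- the push-forward `ρ' = Φ_*ρ`: finite, and `ρ'`-a.e. `θ ∈ (0,1]`
  obtain ⟨ρ', hρ'⟩ : ∃ ρ' : Measure (ℝ × (Fin 2 → ℝ)), ρ' = ρ.map Φ := ⟨_, rfl⟩
  haveI : IsFiniteMeasure ρ' := by
    rw [hρ']
    exact Measure.isFiniteMeasure_map ρ Φ
  have hθae : ∀ᵐ q ∂ρ', q.1 ∈ Set.Ioc (0 : ℝ) 1 := by
    rw [hρ', ae_map_iff hΦm.aemeasurable (measurableSet_Ioc.preimage measurable_fst)]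
    filter_upwards [hS] with p hp
    exact (hΦS p hp).1
  -- integrability of the fibre integrands against `ρ'` (bounded by `1` a.e., finite measure)
  have hInt : ∀ x : Site 3, Integrable (F x) ρ' := by
    intro x
    refine (integrable_const (1 : ℝ)).mono' (hFm x).aestronglyMeasurable ?_
    filter_upwards [hθae] with q hq
    exact hFbd x q hq
  -- disintegrate: `m := ρ'.fst`, `κ := ρ'.condKernel`
  refine ⟨ρ'.fst, ρ'.condKernel, ⟨inferInstance, inferInstance, ?_, ?_, ?_⟩⟩
  · -- window: `m (0,1]ᶜ = ρ' {θ ∉ (0,1]} = 0`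
    rw [Measure.fst_apply measurableSet_Ioc.compl]
    exact ae_iff.1 hθae
  · -- integrability of `θ ↦ u_θ(x)`
    intro x
    simp only [hFun]
    exact (hInt x).integral_condKernel
  · -- the representation `G(x) = ∫ u_θ(x) dm(θ)`
    intro x
    have h1 : ∫ θ, isoMassFun i₀ θ (ρ'.condKernel θ) x ∂ρ'.fst = ∫ q, F x q ∂ρ' := by
      simp only [hFun]
      exact Measure.integral_condKernel (hInt x)
    have h2 : ∫ q, F x q ∂ρ' = ∫ p, F x (Φ p) ∂ρ := by
      rw [hρ']
      exact integral_map hΦm.aemeasurable (hFm x).aestronglyMeasurable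
    rw [hrep x, h1, h2]
    refine integral_congr_ae ?_
    filter_upwards [hS] with p hp
    exact (hFΦ x p hp).symm

end Summit.CriticalPhenomena.Ising3DConformalLimit.Theorems.PerfectScreening.KlBand

end
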